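import Summits.QuantumFields.YangMills.Theses.OnsetSkewLaw
import Summits.QuantumFields.YangMills.Theorems.OnsetTautologyOnsetContraction

/-!
# OnsetSkewLaw — the assembly item

`OnsetSkewLaw.Assembly` (SkewVarianceLaw → PolynomialSeed → RPOnsetFloor → SkewFloorsGlue →
AtomicSide → the R2a-IV leaf) is pure logic: the floors glue yields
`OnsetTautology.ComparableFloors`, and the landed `OnsetTautology.closes` together with
`onsetContraction_proof` and the three OnsetTautology items packed in `AtomicSide` give the leaf.
-/

namespace Summit.QuantumFields.YangMills.Theorems

/-- The assembly of route `OnsetSkewLaw` holds (modus ponens through `OnsetTautology.closes`). -/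
theorem onsetSkewLaw_assembly : Summit.QuantumFields.YangMills.Theses.OnsetSkewLaw.Assembly :=
  fun hL hS hW hG hSide =>
    Summit.QuantumFields.YangMills.Theses.OnsetTautology.closes hSide.1 hSide.2.1 (hG hL hS hW)
      Summit.QuantumFields.YangMills.Theorems.OnsetTautologyOnsetContraction.onsetContraction_proof
      hSide.2.2

end Summit.QuantumFields.YangMills.Theorems
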